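import Literature.NumberTheory.EllipticCurves.KellerYin2024.AnomalousLambdaInvariants
import Literature.NumberTheory.EllipticCurves.PAdicHeights
import HarnessLib

/-!
# `halves` stub 3a (`stub_anThreeTrivial`, AN-3) SPLIT ALONG ITS MEASURED FAILURE LOCUS, TYPED — ideator supplement
# (crux 2 `GoodLatticeBDPValue`, stmt-BirchSwinnertonDyer-19032; seat `bsd-idea-11` g9, lens nearmiss;
# NOT a registered line, NOT a LEAD file: `Lines/halves.lean` (v19.1, LEAD `bsd-line-x1-p1`) is untouched and remains
# the skeleton of record; W-71 (no route births / items) and W-79 (no `skeleton check --crux`) honoured)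
# rev 1.1 (2026-08-28T16:05Z): Kriz Rem. 33 page/line locators corrected to this folder's materialisation (first sentence p0021 L1, θ-sentence L5, consequence L9); Lean code byte-identical to rev 1 (commit 7e5af8d9dd75).
# rev 1.2: + §3b `FullDescentAtThreeOfSemistableRed` (Theorem T in Ohta's square-free generality) with the sorry-free lift `fullDescentAtThreeOfRed_of_semistable` and `anThreeTrivial_of_ohtaForm`; stubs unchanged (2 sorries), earlier code byte-identical.

NO SUMMIT STATEMENT AND NO CRUX IS PROVED HERE. This file contains three `def … : Prop` (nothing asserted), two
`sorry`'d stubs, and sorry-free LOGIC joining them to the LEAD's stub 3a type token for token.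

## What this file does (answers referee wave g94 §3.8, `pub/bsd-eis/REF-VERDICT-WAVE-g94.md`)

`stub_anThreeTrivial` (halves v19.1 :232) = the `p = 3 ∧ 𝟙̃|_{G_K} = 𝟙` slice of the preprint claim
`KellerYin2024.thm222_anacong_goodLattice_OPEN` — the ONE remaining PRE brick on the analytic side of crux 2
(census weight 1 303 of 1 487 type-A classes). It is PRE for one located reason: the printed proof of CGLS
Thm. 2.2.1 (arXiv:2008.02571v2 TeX L1073–1078, (eq:cong-mf) `f ≡ G (mod p)`) needs FULL Eisenstein descent,
and Kriz 2016 Rem. 33 prints it unconditionally only through the θ-injectivity sentence «Suppose p > k + 1»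
(= `p ≥ 5` at weight 2) [corpus: paper:arxiv-1512.05032 p0021 L5–L9]; whence the tree's PUB-composed
`thm222_anacong_goodLattice_of_five_le` and the PRE residue at `p = 3` (referee C3 R428 / R500).

The near-miss (memo `Lines/halves_anThree_fullDescent_idea11g7.md` rev 3.3, critic V51/V53 PASS): Rem. 33's
FIRST sentence is `p`-free — «Now further suppose that ψ₂ = 1. Then (5) is still forced to hold unless
N₋N₀ = 1» [corpus: paper:arxiv-1512.05032 p0021 L1; Rem. 33 = p0020 L71 – p0021 L17] — and Kriz Thm. 34 (3) leaves the admissible type free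
(«N₋ any product of ℓ ∥ N satisfying a_ℓ ≡ ψ₂(ℓ)ℓ^{k−1} mod λ» [ibid. p0021 L31–L33]). So FULL descent mod `p` of
type `(𝟙, 𝟙, N₊, N₋, N₀)` is available AS PRINTED, at every `p`, as soon as the curve carries the elementary datum
  FD(E, p):  some prime of ADDITIVE reduction (N₀ ≠ 1), or some multiplicative prime `ℓ` with `a_ℓ ≡ ℓ (mod p)`
             (i.e. split with `ℓ ≡ 1 (mod p)`, or non-split with `ℓ ≡ −1 (mod p)`) (an admissible `N₋ ≠ 1`).
The referee (g94 §3.8) ruled: a UNIVERSAL relabel of AN-3 to PUB-composed is NOT admissible while the statement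
«FD(E, 3) always holds in case (a)» (Theorem T of the memo) is cell mathematics; the PER-CLASS road (FD as a
decidable certificate on `(N, (a_ℓ)_{ℓ∣N})`) DOES match the `p ≥ 5` composed-PUB shape; and «the cleanest
vehicle moots the register question: TYPE Theorem T (+ the join) in Lean». This file is that typing:

* §1 `FullDescentDatumAt W p` — FD(E, p) over tree predicates (`Rank1Residual.Addv`,
  `HasMultiplicativeReductionAtPrime`, `HasSplitMultiplicativeReductionAtPrime`, `Nat.ModEq`), with its three
  one-line constructors (the per-class certificate shapes);
* §2 `AnacongOfFullDescentDatum` — the body of `thm222_anacong_goodLattice_OPEN` BYTE FOR BYTE with ONE extra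
  binder `FullDescentDatumAt W p →` after `Anom W p →`: the candidate COMPOSED-OF-REFEREED-PRINT sibling at EVERY
  odd `p` (chain: Kriz Thm. 35 / Thm. 34 (3) partial descent for the admissible type with `N₋N₀ ≠ 1` chosen from
  the datum ∘ Rem. 33 first sentence (full descent, `p`-free) ∘ CGLS Thms. 2.2.1/2.2.2 proofs verbatim ∘ Hida
  `μ = 0` ∘ Kriz Thm. 27 — the `_of_five_le` chain with Rem. 33's θ-sentence replaced by its first sentence).
  REGISTER IS NOT MINE TO GRANT: candidate only; ARM P / TY name the vehicle (suggested
  `KellerYin2024.thm222_anacong_goodLattice_of_fullDescentDatum`); I propose no Literature file (W-71);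
* §3 `FullDescentAtThreeOfRed` — Theorem T′ typed: `p = 3 → Good W p → Red W p → FullDescentDatumAt W p`
  (= memo Theorem T «3 ∤ N ∧ E[3]^ss ≅ 𝟙 ⊕ ω ⇒ FD(E,3)», proved in the memo §3 from Chen–Kiming–Rasmussen 2010
  Thm. 1 (i) [corpus: paper:arxiv-0809.3622 p0004 L1–L12], + Lemma S «semistable away from 3, good at 3, E[3]
  reducible ⇒ E[3]^ss ≅ 𝟙 ⊕ ω» = Kriz Thm. 34 (1) with its proof «one of {χ₁, χ₂} is unramified outside the
  squarefull part of N» [corpus: paper:arxiv-1512.05032 p0021 L27–L29, L35 – p0022 L1], Serre 1972 §5.4 for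
  curves). STATUS: the memo's proof is cell mathematics with refereed inputs (PRE); BUT (ARM P reader sheet S18,
  `pub/bsd-cited/sheets/D-AUDIT-r13-S18-Kriz16Rem33-CKR10-p3.md` 53baaf524c22c496 §4, 2026-08-28T15:35Z) the CONTENT
  of Theorem T is IN REFEREED PRINT: Ohta, Tokyo J. Math. 37 (2014) Prop. (3.3.3) — at `p = 3`, `3 ∤ N` square-free,
  the Eisenstein ideal is the UNIT ideal in the Atkin–Lehner sign component `ε_H = ((ℓᵢ/3))ᵢ`
  [corpus: paper:doi-10-3836-tjm-1422452795 p0035 L10–L14] — reached from T′'s hypotheses by the reader's four-line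
  dictionary D1–D4 (sheet §4B), corroborated by Yoo, Math. Z. 282 (2016) Thm. 1.1 and by the memo's CKR/Katz route.
  REGISTER: CANDIDATE PUB-composed (referee C3's word, R428 standard; the reader filed the C3 wake); until then a named
  hypothesis; no kernel proof; per-curve instances decidable by Tate's algorithm (certificate = witness prime + type);
* §4 the verbatim copy `AnacongAtThreeTrivial` of stub 3a's statement and the SORRY-FREE join
  `anThreeTrivial_of_pieces : AnacongOfFullDescentDatum → FullDescentAtThreeOfRed → AnacongAtThreeTrivial`
  (instantiate, feed `hT W p hp hgood hred`), restated ON THE NOSE of halves' `h3` binder type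
  (`halves_h3_of_pieces`), plus the bookkeeping bridges `AnacongOfFullDescentDatum.of_OPEN` (the new fact is
  WEAKER than the preprint claim) and `anThree_of_pieces` (the two pieces return the whole `p = 3` slice of
  `_OPEN`'s body, case (b) included — the split loses nothing at `p = 3`);
* §5 two stubs `stub_anacongOfFullDescentDatum` (PUB-composable candidate) and `stub_fullDescentAtThreeOfRed`
  (PRE, cell theorem) — the only `sorry`s of the file — and `stub3a_recomposed`, showing the LEAD's stub 3a is
  literally their composition.

## What the LEAD may do with it (its call, at a cycle boundary; nothing here obliges it)

Replace stub 3a by the two stubs of §5 and the join (net: the PRE content of crux 2's analytic side shrinks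
from «KY Thm. 2.2.2 at (3, 𝟙)» to the elementary, per-curve-decidable `FullDescentAtThreeOfRed`; the other
factor is in the exact shape the referee already accepts at `p ≥ 5`), or keep stub 3a and cite this file as
the typed form of the AN-3 memo. Either way `Lines/halves.lean` is edited only by the LEAD.

## Census (memo §4; kit 0, local seconds; universes named)

Atlas of record `cells_R196_10`, X1a, r = 1, p = 3: 7 522 classes = 528 case (b) + 6 994 case (a); of the
6 994: 2 157 with an additive prime, 4 139 squarefree with some ℓ ≡ 1 (mod 3) (split, forced), 698 squarefree
with all ℓ ≡ 2 (mod 3) and a non-split prime, 0 without an FD witness. All Cremona classes N < 5·10⁵, 3 ∤ N,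
rational 3-torsion in the class: 15 267 = 4 699 + 8 833 + 1 735 + 0. (The halves docstring's «1 303 of 1 487»
is the D-AUDIT-r19 type-A universe; all three universes show 0 classes outside FD.)

## Typing notes

* `a_ℓ` at a multiplicative prime is NOT read through `WeierstrassCurve.frobeniusTrace` (tree convention
  `GlobalMinimalModel.lean`: `p + 1 − #Ẽ(𝔽_p)` counts all points of the singular fibre, giving 2 / 0, not ±1);
  the split / non-split predicate `HasSplitMultiplicativeReductionAtPrime` (`PAdicHeights.lean` :217) is used
  instead: split ⟺ `a_ℓ = +1`, non-split ⟺ `a_ℓ = −1` (Tate; Silverman AEC VII.5, ATAEC V.5.3).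
* `ℓ ≡ −1 (mod p)` is written `ℓ + 1 ≡ 0 [MOD p]` (ℕ-valued, no subtraction).
* No `instance`, no `notation`, no import of other `Lines/*.lean` (their stubs are `sorry`'d): the statement of
  stub 3a is COPIED (§4) and the identity with halves' binder type is exhibited by `halves_h3_of_pieces`, whose
  displayed type is halves v19.1 :266–:296 (`h3`) token for token.

[cite: Kriz2016, Def. 31, Rem. 32, Rem. 33 (first sentence; θ-sentence), Thm. 34 (1)–(3) and proof of (1), Thm. 35, Thm. 27 — ANT 10 (2016) 309–374 = arXiv:1512.05032, pp. 20–22 of the arXiv text]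
[cite: CastellaGrossiLeeSkinner2022, Thm. 2.2.1 (thm:kriz) and Thm. 2.2.2 (cor:Kriz) with (2.16), proofs arXiv:2008.02571v2 TeX L1051–1153; «φ ≠ 𝟙» used only at L1073–1078]
[cite: ChenKimingRasmussen2010, Thm. 1 (i) (J. Number Theory 130 (2010) 608–619 = arXiv:0809.3622, p. 4)]
[cite: Ohta2014, Prop. (3.3.3), Thm. (3.1.3) (Tokyo J. Math. 37 (2014) 273–318; VoR text p0035 L10–14, p0030)] [cite: Yoo2015, Thm. 1.1]
[cite: AtkinLehnerMathAnn1970, Thm. 3 (w_ℓ-eigenvalue = −a_ℓ at ℓ ∥ N)]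
[cite: Hida2010MuInvariant, Thm. I] [claim: KellerYin2024, status: under-review — Thm. 2.2.2 at (p, φ) = (3, 𝟙) is the statement being split; no step of the preprint is used by §2]
-/

-- the summit namespace `Summit.BirchSwinnertonDyer.BirchSwinnertonDyer` repeats the problem name by design (D-0017)
set_option linter.dupNamespace false
set_option autoImplicit false

noncomputable section

open scoped Classical

open PowerSeries WeierstrassCurve NumberField IsDedekindDomain Field
  Literature.NumberTheory.EllipticCurves Literature.NumberTheory.EllipticCurves.ModularForms
  Literature.NumberTheory.QuadraticFields Literature.NumberTheory.EllipticCurves.Rank1Residual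
  Literature.NumberTheory.EllipticCurves.Castella2018 Literature.NumberTheory.EllipticCurves.GreenbergSelmer
  Literature.NumberTheory.EllipticCurves.GreenbergVatsal2000 Literature.NumberTheory.GaloisRepresentations
  Literature.NumberTheory.EllipticCurves.CastellaGrossiLeeSkinner2022
  Literature.NumberTheory.EllipticCurves.KellerYin2024

namespace Summit.BirchSwinnertonDyer.BirchSwinnertonDyer.Cruxes.GoodLatticeBDPValue.HalvesAnThreeSplit

/-! ## §1 The full-descent datum FD(E, p) — Kriz Def. 31 / Rem. 33 first sentence at (k, ψ₁, ψ₂) = (2, 𝟙, 𝟙), decoded -/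

/-- **FD(E, p), the full-Eisenstein-descent datum of type `(𝟙, 𝟙)` mod `p`**: `E` has a prime `ℓ` of ADDITIVE
reduction (so the squarefull part `N₀` of `N` is `≠ 1`), or a prime `ℓ` of MULTIPLICATIVE reduction with
`a_ℓ ≡ ψ₂(ℓ)ℓ^{k−1} = ℓ (mod p)` — split (`a_ℓ = +1`) with `ℓ ≡ 1 (mod p)`, or non-split (`a_ℓ = −1`) with
`ℓ ≡ −1 (mod p)` — so that the admissible type of Kriz Thm. 34 (3) can be chosen with `N₋ ≠ 1`. By Rem. 33,
first sentence («(5) is still forced to hold unless N₋N₀ = 1», `p`-free: the constant term of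
`E₂^{𝟙,𝟙,(N₊,N₋,N₀)}` carries the factor `∏_{ℓ∣N₋}(1 − ψ₂(ℓ))·∏_{ℓ∣N₀}(…)(1 − ψ₂(ℓ)) = 0`, Rem. 32), partial
descent of such a type IS full descent. A statement about `E/ℚ` alone (no `K`, no rank); it depends only on
`N` and the `a_ℓ`, `ℓ ∣ N`, hence only on the isogeny class; each instance is decidable by Tate's algorithm.
A PREDICATE (definition with a body; nothing asserted).
[cite: Kriz2016, Def. 31 (conditions (1)–(5)), Rem. 32, Rem. 33 (first sentence), Thm. 34 (2)–(3) (arXiv:1512.05032 p0020 L30 – p0021 L33)]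
[cite: SilvermanAEC2009, VII.5 (split / non-split multiplicative reduction; a_ℓ = ±1 at ℓ ∥ N via the Tate curve)] -/
def FullDescentDatumAt (W : WeierstrassCurve ℚ) (p : ℕ) : Prop :=
  (∃ (ℓ : ℕ) (hℓ : ℓ.Prime), haveI : Fact ℓ.Prime := ⟨hℓ⟩; Addv W ℓ) ∨
  (∃ (ℓ : ℕ) (hℓ : ℓ.Prime), haveI : Fact ℓ.Prime := ⟨hℓ⟩;
    W.HasMultiplicativeReductionAtPrime ℓ ∧
      ((W.HasSplitMultiplicativeReductionAtPrime ℓ ∧ ℓ ≡ 1 [MOD p]) ∨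
        (¬ W.HasSplitMultiplicativeReductionAtPrime ℓ ∧ ℓ + 1 ≡ 0 [MOD p])))

section Certificates

variable {W : WeierstrassCurve ℚ} {p : ℕ}

/-- Certificate shape (N₀): an additive prime is an FD witness. [cite: Kriz2016, Rem. 33 (first sentence)] -/
theorem FullDescentDatumAt.of_addv (ℓ : ℕ) [hℓ : Fact ℓ.Prime] (h : Addv W ℓ) : FullDescentDatumAt W p :=
  Or.inl ⟨ℓ, hℓ.out, h⟩

/-- Certificate shape (N₋, split): a split multiplicative prime `ℓ ≡ 1 (mod p)` is an FD witness
(`a_ℓ = 1 ≡ ℓ`). [cite: Kriz2016, Thm. 34 (2)–(3), Rem. 33 (first sentence)] -/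
theorem FullDescentDatumAt.of_split (ℓ : ℕ) [hℓ : Fact ℓ.Prime]
    (h : W.HasSplitMultiplicativeReductionAtPrime ℓ) (hmod : ℓ ≡ 1 [MOD p]) : FullDescentDatumAt W p :=
  Or.inr ⟨ℓ, hℓ.out, h.hasMultiplicativeReductionAtPrime, Or.inl ⟨h, hmod⟩⟩

/-- Certificate shape (N₋, non-split): a non-split multiplicative prime `ℓ ≡ −1 (mod p)` is an FD witness
(`a_ℓ = −1 ≡ ℓ`). [cite: Kriz2016, Thm. 34 (2)–(3), Rem. 33 (first sentence)] -/
theorem FullDescentDatumAt.of_nonsplit (ℓ : ℕ) [hℓ : Fact ℓ.Prime]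
    (hm : W.HasMultiplicativeReductionAtPrime ℓ) (hns : ¬ W.HasSplitMultiplicativeReductionAtPrime ℓ)
    (hmod : ℓ + 1 ≡ 0 [MOD p]) : FullDescentDatumAt W p :=
  Or.inr ⟨ℓ, hℓ.out, hm, Or.inr ⟨hns, hmod⟩⟩

end Certificates

/-! ## §2 [AN] given the datum, at every odd `p` — the candidate COMPOSED-OF-REFEREED-PRINT sibling of `_of_five_le` -/

/-- **CGLS 2022 Thms. 2.2.1/2.2.2 with (2.16) ∘ Kriz 2016 (Thm. 35, Thm. 34 (3), Rem. 33 FIRST SENTENCE) ∘ Hida 2010,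
GIVEN the full-descent datum: the anomalous-congruence good-lattice ANALYTIC statement without «`φ ≠ 𝟙`» at
every odd `p`, for curves carrying FD(E, p).** Statement: the body of
`KellerYin2024.thm222_anacong_goodLattice_OPEN` byte for byte with ONE extra binder `FullDescentDatumAt W p →`
after `Anom W p →`. WHY THIS IS (CANDIDATE) PRINT: identical to the accepted `p ≥ 5` composition
`thm222_anacong_goodLattice_of_five_le` (referee C3 R428 OPTION B) except at its single `p`-dependent link —
full descent for the displayed congruence (eq:cong-mf) of CGLS Thm. 2.2.1 (arXiv:2008.02571v2 TeX L1073–1078)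
is obtained not from Rem. 33's θ-sentence («Suppose p > k + 1», p0021 L5; consequence «Hence, if 𝔪 has order 0 or 1 … p > k+1, then (5) is forced to hold» L9) but from its first sentence («(5) is
still forced to hold unless N₋N₀ = 1», p0021 L1 — the sentence «Now further suppose that ψ₂ = 1. Then (5) is still forced to hold unless N₋N₀ = 1», no condition on `p`) applied to an admissible type with
`N₋N₀ ≠ 1`, which the datum supplies and which Kriz Thm. 34 (3) («N₋ any product …») and CGLS Thm. 2.2.1's
existential statement («there is a factorization …») allow us to choose; Thm. 2.2.2's conclusion (this body's
`∃ n nφ, …`) does not mention the type. All other steps are the `φ`-free, `p`-odd steps already inside the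
PUBLISHED `thm222_anacong_goodLattice_of_ne_one` (`2 < p`). REGISTER: CANDIDATE composed-PUB — the label is the
referee's (ARM P C3) to grant and the vehicle TY's to name; until then treat as a NAMED HYPOTHESIS (D-0014),
nothing asserted. Weaker than the preprint claim (`AnacongOfFullDescentDatum.of_OPEN`).
[cite: CastellaGrossiLeeSkinner2022, Thm. 2.2.1 (thm:kriz), Thm. 2.2.2 (cor:Kriz) with (2.16), proofs arXiv:2008.02571v2 TeX L1051–1153]
[cite: Kriz2016, Thm. 35, Thm. 34 (3), Def. 31, Rem. 32, Rem. 33 (first sentence), Thm. 27 (arXiv:1512.05032 p0020 L30 – p0022 L26)]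
[cite: Hida2010MuInvariant, Thm. I (μ = 0, as used at CGLS L1132)] -/
def AnacongOfFullDescentDatum : Prop :=
  ∀ (W : WeierstrassCurve ℚ) [W.IsElliptic] [W.IsGloballyMinimal] (p : ℕ) [Fact p.Prime],
    2 < p → Good W p → Red W p → Anom W p → FullDescentDatumAt W p →
    (∀ Φ : AddSubgroup (geomTorsion W (p : ℤ)), IsRationalLine W p Φ → ¬ LineUnramifiedAt W p Φ) →
    ∀ (K : Type) [Field K] [NumberField K], IsImaginaryQuadratic K →
      SatisfiesHeegnerHypothesis (W.conductorNorm ℤ) K → SatisfiesHeegnerHypothesis p K →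
      Odd (NumberField.discr K) → NumberField.discr K ≠ -3 →
      (∀ Q : (W.baseChange K).toAffine.Point, p • Q = 0 → Q = 0) →
    ∀ (ι : K →+* ℚ_[p]) (v vbar : HeightOneSpectrum (𝓞 K)),
      (∀ x : 𝓞 K, x ∈ v.asIdeal ↔ ‖ι (x : K)‖ < 1) →
      ((p : ℕ) : 𝓞 K) ∈ vbar.asIdeal → vbar ≠ v →
    ∀ (κ : ZpExtension K p), κ.IsAnticyclotomic →
    ∀ (γ : absoluteGaloisGroup K) [Fact (κ.IsTopGenerator γ)],
    ∀ (N : ℕ) [NeZero N] (Dt : ModularParametrizationData W N),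
    ∀ (ι' : PadicAlgCl p ≃+* ℂ),
      (∀ (w : InfinitePlace K) (k : 𝓞 K), k ∈ v.asIdeal ↔ ‖ι'.symm (w.embedding (k : K))‖ < 1) →
    ∀ (ΩK : ℂ) (Ωp : (unrIntegers p)ˣ) (L : UnrSeries p), ΩK ≠ 0 →
      IsBDPLFunction ι' v κ γ Dt.f ΩK ((Ωp : unrIntegers p) : ℂ_[p]) L →
    ∀ (θsub θquot : FramedGaloisRep K (padicCoeffIntegers (∅ : Set (PadicAlgCl p))) 1),
      IsResidualPairOver (W.baseChange K) p θsub θquot →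
    ∀ (Sf : Finset (HeightOneSpectrum (𝓞 K))),
      (∀ w : HeightOneSpectrum (𝓞 K), w ∈ Sf ↔ ((W.conductorNorm ℤ : ℤ) : 𝓞 K) ∈ w.asIdeal) →
    ∀ (θK : HeckeCharacter K), IsHeckeCharOf ι' θquot θK →
    ∀ (Cbar : Finset (HeightOneSpectrum (𝓞 K))), (∀ u ∈ Cbar, ¬ θK.IsUnramifiedAt u) →
    ∀ (ΩK' : ℂ) (Ωp' : (unrIntegers p)ˣ) (Lφ : UnrSeries p), ΩK' ≠ 0 →
      IsKatzLFunction ι' v vbar Cbar κ γ θK ΩK' ((Ωp' : unrIntegers p) : ℂ_[p]) Lφ →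
    ∃ n nφ : ℕ, FirstUnitCoeffAt L n ∧ FirstUnitCoeffAt Lφ nφ ∧
      n + ∑ w ∈ Sf, curveLocalLambda κ (W.baseChange K) w =
        2 * nφ + ∑ w ∈ Sf, (charLocalLambda ∅ κ θsub w + charLocalLambda ∅ κ θquot w)

/-- **Bookkeeping bridge (PROVED)**: the preprint claim at every odd `p` implies the datum-conditioned statement
(the extra binder is discarded) — `AnacongOfFullDescentDatum` is WEAKER than `thm222_anacong_goodLattice_OPEN`.
[cite: KellerYin2024, Thm. 2.2.2 (arXiv:2402.12781v2 TeX L1445–1448)] [cite: Kriz2016, Rem. 33] -/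
theorem AnacongOfFullDescentDatum.of_OPEN (h : thm222_anacong_goodLattice_OPEN) : AnacongOfFullDescentDatum :=
  fun W _ _ p _ hp hgood hred hanom _ hlat K _ _ hK hH hHp hodd hd3 htor ι v vbar hv hvbar hne κ hκ γ _
      N _ Dt ι' hι' ΩK Ωp L hΩ hL θsub θquot hpair Sf hSf θK hθK Cbar hC ΩK' Ωp' Lφ hΩ' hLφ ↦
    h W p hp hgood hred hanom hlat K hK hH hHp hodd hd3 htor ι v vbar hv hvbar hne κ hκ γ N Dt ι' hι'
      ΩK Ωp L hΩ hL θsub θquot hpair Sf hSf θK hθK Cbar hC ΩK' Ωp' Lφ hΩ' hLφ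

/-! ## §3 Theorem T′ typed — the datum is ALWAYS present at a good reducible `3` (cell mathematics, PRE) -/

/-- **Theorem T′ (AN-3 memo rev 3.3 §3 Theorem T + Lemma S), TYPED: at `p = 3`, good reduction at `3` and `E[3]`
reducible imply FD(E, 3).** In words: an elliptic curve over `ℚ` with `3 ∤ N` and `E[3]` reducible has a prime of
additive reduction, or a multiplicative prime `ℓ` with `a_ℓ ≡ ℓ (mod 3)` (split `ℓ ≡ 1`, or non-split `ℓ ≡ 2`,
`ℓ = 2` allowed). REDUCTION TO THE MEMO: if `E` has no additive prime it is semistable away from `3` and good at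
`3`, and then (Lemma S) `E[3]^ss ≅ 𝟙 ⊕ ω` — Kriz Thm. 34 (1) and its proof («one of {χ₁, χ₂} is unramified
outside the squarefull part of N», here `= 1`; a character of `G_ℚ` into `𝔽₃ˣ` unramified outside `3` is `𝟙` or
`ω`), the elliptic-curve case being Serre 1972 §5.4 — so memo Theorem T applies: were every `ℓ ∣ N` split with
`ℓ ≡ 2 (mod 3)`, partial descent (Kriz Thm. 35) would make `H := 24(f − E₂^{𝟙,𝟙,(N,1,1)})` an integral
weight-2 form on `Γ₀(N)` congruent mod `9` to the `3`-unit `∏_{ℓ∣N}(1 − ℓ)`, and after the level-`2N`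
renormalisation of memo §3 Step 3 the refereed weight-congruence theorem of Chen–Kiming–Rasmussen (Thm. 1 (i),
`m = 2`, `s = 1`: weights congruent mod `6`) gives `2 ≡ 4 (mod 6)`, absurd. In case (b) (`E[3]^ss ≅ χ ⊕ χω`,
`χ` quadratic `≠ 𝟙`) the curve has an additive prime by Lemma S, so T′ holds there trivially.
STATUS. (i) The memo's proof is cell mathematics from refereed inputs (CKR 2010 Thm. 1 (i), underlying Katz 1973
Cor. 4.4.2 = acq-11035, open; Kriz Thm. 34/35), critic-read (V51/V53 PASS). (ii) IN REFEREED PRINT (ARM P reader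
sheet S18 `pub/bsd-cited/sheets/D-AUDIT-r13-S18-Kriz16Rem33-CKR10-p3.md` 53baaf524c22c496 §4, 2026-08-28): the
content of Theorem T is Ohta 2014 Prop. (3.3.3) — «Assume that p = 3, and ε = ε_H when 3 ∤ N …. Then we have
I^ε_{ℤ₍₃₎} = 𝕋(N; ℤ₍₃₎)^ε» [corpus: paper:doi-10-3836-tjm-1422452795 p0035 L10–L14], i.e. for `3 ∤ N` square-free
the weight-2 Eisenstein ideal is the UNIT ideal in the Atkin–Lehner sign component `ε_H := ((ℓ₁/3), …, (ℓ_m/3))`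
((2.3.7); index theorem (3.1.3) with `c(N; ε)` of (3.1.2), p0030) — reached from T′'s hypotheses by the reader's
dictionary D1–D4: (D1) the newform `f_E` gives a ring map `θ : 𝕋(N; ℤ₍₃₎)^ε → ℤ₍₃₎`, `ε = (−a_ℓ)_{ℓ∣N}`
(Atkin–Lehner 1970 Thm. 3: `w_ℓ`-eigenvalue `= −a_ℓ` at `ℓ ∥ N`); (D2) `E[3]^ss ≅ 𝟙 ⊕ ω` ⇒ `a_ℓ ≡ 1 + ℓ (mod 3)`
for `ℓ ∤ N` (Kriz Thm. 34 (3) / Def. 31 (1), `ℓ = 3` included) ⇒ `θ(I^ε) ⊆ 3ℤ₍₃₎` ⇒ `I^ε ≠ 𝕋^ε`; (D3) PD-only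
(every `ℓ ∣ N` split, `≡ 2 (mod 3)`) ⇒ `εᵢ = −1 = (ℓᵢ/3)` ⇒ `ε = ε_H`; (D4) contradiction with (3.3.3).
Corroborated by Yoo, Math. Z. 282 (2016) Thm. 1.1 (`𝕋_N/I_M ⊗ ℤ_y ≅ ℤ/m ⊗ ℤ_y`, `m = num(φ(N)ψ(N/M)/3)`, `y ∤ 2N`;
`M = N`, all `ℓ ≡ 2 (mod 3)` ⇒ `3 ∤ m`). REGISTER: CANDIDATE PUB-composed (Ohta 2014 ∘ Atkin–Lehner 1970 ∘ Kriz 2016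
Thm. 34 ∘ Lemma S) — the word is referee C3's (R428 standard; the reader filed the C3 wake); until then a NAMED
HYPOTHESIS (D-0014); not kernel-proved. (iii) Per-curve instances decidable (Tate's algorithm) and checked: 0
exceptions among 15 267 Cremona classes (N < 5·10⁵, 3 ∤ N, rational 3-torsion in the class; g9 table
`an3g9/fd_witness_p3_N500k.tsv`: 4 699 additive / 8 833 split `ℓ ≡ 1` / 1 735 non-split `ℓ ≡ 2` / 0 none) and 0
among the 6 994 case-(a) atlas classes. A named `Prop` (nothing asserted); `stub_fullDescentAtThreeOfRed` below is
its `sorry`'d stub.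
[cite: Ohta2014, Prop. (3.3.3) (p. 35 L10–14 of the VoR text), Thm. (3.1.3) with (3.1.2), (2.3.7) (Tokyo J. Math. 37 (2014) 273–318)]
[cite: Yoo2015, Thm. 1.1 (Math. Z. 282 (2016) 1097–1116)] [cite: AtkinLehnerMathAnn1970, Thm. 3]
[cite: ChenKimingRasmussen2010, Thm. 1 (i) (arXiv:0809.3622 p. 4 L1–L12; J. Number Theory 130 (2010) 608–619)]
[cite: Kriz2016, Thm. 34 (1)–(3) with proof of (1), Thm. 35, Def. 31, Rem. 32 (arXiv:1512.05032 p0021 L27 – p0022 L26)]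
[cite: SilvermanAEC2009, VII.5 (reduction types; Tate's algorithm decides each instance)] -/
def FullDescentAtThreeOfRed : Prop :=
  ∀ (W : WeierstrassCurve ℚ) [W.IsElliptic] [W.IsGloballyMinimal] (p : ℕ) [Fact p.Prime],
    p = 3 → Good W p → Red W p → FullDescentDatumAt W p

/-! ### §3b Ohta's natural generality: the semistable (square-free conductor) case suffices -/

/-- **Theorem T in OHTA'S GENERALITY (semistable case of T′)**: for `E/ℚ` SEMISTABLE (square-free `N`), with
good reduction at `3` and `E[3]` reducible, some multiplicative prime `ℓ` has `a_ℓ ≡ ℓ (mod 3)` (split with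
`ℓ ≡ 1`, or non-split with `ℓ ≡ 2 (mod 3)`). This is exactly the setting of Ohta 2014 Prop. (3.3.3) («`3 ∤ N`»,
`N = ℓ₁ ⋯ ℓ_m` square-free, `ε = ε_H`) read through the dictionary D1–D4 of §3's docstring; a by-name vehicle for
Stub B may therefore be stated in THIS form (print hypotheses on the nose) and lifted to T′ by
`fullDescentAtThreeOfRed_of_semistable` below (the non-semistable case carries an additive prime, which IS a
full-descent datum). A named `Prop` (nothing asserted).
[cite: Ohta2014, Prop. (3.3.3), Thm. (3.1.3) with (3.1.2), (2.3.7)] [cite: Yoo2015, Thm. 1.1]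
[cite: AtkinLehnerMathAnn1970, Thm. 3] [cite: Kriz2016, Thm. 34 (1)–(3)] -/
def FullDescentAtThreeOfSemistableRed : Prop :=
  ∀ (W : WeierstrassCurve ℚ) [W.IsElliptic] [W.IsGloballyMinimal] (p : ℕ) [Fact p.Prime],
    p = 3 → Good W p → Red W p → Semistable W →
      ∃ (ℓ : ℕ) (hℓ : ℓ.Prime), haveI : Fact ℓ.Prime := ⟨hℓ⟩;
        W.HasMultiplicativeReductionAtPrime ℓ ∧
          ((W.HasSplitMultiplicativeReductionAtPrime ℓ ∧ ℓ ≡ 1 [MOD p]) ∨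
            (¬ W.HasSplitMultiplicativeReductionAtPrime ℓ ∧ ℓ + 1 ≡ 0 [MOD p]))

/-- **Lift: Ohta's semistable form ⟹ T′** (sorry-free logic: a non-semistable curve has a prime that is neither
good nor multiplicative, i.e. an additive prime `Addv W ℓ`, which is the first disjunct of the datum). -/
theorem fullDescentAtThreeOfRed_of_semistable (h : FullDescentAtThreeOfSemistableRed) :
    FullDescentAtThreeOfRed := by
  intro W _ _ p _ hp hgood hred
  by_cases hs : Semistable W
  · exact Or.inr (h W p hp hgood hred hs)
  · simp only [Semistable, not_forall, not_or] at hs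
    obtain ⟨ℓ, hℓ, hng, hnm⟩ := hs
    exact Or.inl ⟨ℓ, hℓ, ⟨hng, hnm⟩⟩

/-! ## §4 Stub 3a's statement (verbatim) and the sorry-free join -/

/-- **[AN]-3-𝟙 — KY Thm. 2.2.2 (`anacong`) for the good lattice at `p = 3` and `𝟙̃|_{G_K} = 𝟙`**: the statement
of halves v19.1 `stub_anThreeTrivial` (:232) = idea-11 g4's `HalvesAnSplit.AnacongAtThreeTrivial`, COPIED token
for token (the body of `thm222_anacong_goodLattice_OPEN` with `2 < p` ↦ `p = 3` and the extra binder
`∀ σ, θquot σ = 1`). Copied, not imported: `Lines/*.lean` carry `sorry`'d stubs and are never imported here.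
A named `Prop` (nothing asserted); its register is discussed in the module docstring and the card.
[claim: KellerYin2024, status: under-review]
[cite: KellerYin2024, Thm. 2.2.2 and proof of Thm. 2.2.1 (arXiv:2402.12781v2 TeX L1426–1448)]
[cite: Kriz2016, Thm. 35, Thm. 34 (3), Rem. 33] [cite: CastellaGrossiLeeSkinner2022, Thm. 2.2.2 with (2.16)] -/
def AnacongAtThreeTrivial : Prop :=
  ∀ (W : WeierstrassCurve ℚ) [W.IsElliptic] [W.IsGloballyMinimal] (p : ℕ) [Fact p.Prime],
    p = 3 → Good W p → Red W p → Anom W p →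
    (∀ Φ : AddSubgroup (geomTorsion W (p : ℤ)), IsRationalLine W p Φ → ¬ LineUnramifiedAt W p Φ) →
    ∀ (K : Type) [Field K] [NumberField K], IsImaginaryQuadratic K →
      SatisfiesHeegnerHypothesis (W.conductorNorm ℤ) K → SatisfiesHeegnerHypothesis p K →
      Odd (NumberField.discr K) → NumberField.discr K ≠ -3 →
      (∀ Q : (W.baseChange K).toAffine.Point, p • Q = 0 → Q = 0) →
    ∀ (ι : K →+* ℚ_[p]) (v vbar : HeightOneSpectrum (𝓞 K)),
      (∀ x : 𝓞 K, x ∈ v.asIdeal ↔ ‖ι (x : K)‖ < 1) →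
      ((p : ℕ) : 𝓞 K) ∈ vbar.asIdeal → vbar ≠ v →
    ∀ (κ : ZpExtension K p), κ.IsAnticyclotomic →
    ∀ (γ : absoluteGaloisGroup K) [Fact (κ.IsTopGenerator γ)],
    ∀ (N : ℕ) [NeZero N] (Dt : ModularParametrizationData W N),
    ∀ (ι' : PadicAlgCl p ≃+* ℂ),
      (∀ (w : InfinitePlace K) (k : 𝓞 K), k ∈ v.asIdeal ↔ ‖ι'.symm (w.embedding (k : K))‖ < 1) →
    ∀ (ΩK : ℂ) (Ωp : (unrIntegers p)ˣ) (L : UnrSeries p), ΩK ≠ 0 →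
      IsBDPLFunction ι' v κ γ Dt.f ΩK ((Ωp : unrIntegers p) : ℂ_[p]) L →
    ∀ (θsub θquot : FramedGaloisRep K (padicCoeffIntegers (∅ : Set (PadicAlgCl p))) 1),
      IsResidualPairOver (W.baseChange K) p θsub θquot → (∀ σ : absoluteGaloisGroup K, θquot σ = 1) →
    ∀ (Sf : Finset (HeightOneSpectrum (𝓞 K))),
      (∀ w : HeightOneSpectrum (𝓞 K), w ∈ Sf ↔ ((W.conductorNorm ℤ : ℤ) : 𝓞 K) ∈ w.asIdeal) →
    ∀ (θK : HeckeCharacter K), IsHeckeCharOf ι' θquot θK →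
    ∀ (Cbar : Finset (HeightOneSpectrum (𝓞 K))), (∀ u ∈ Cbar, ¬ θK.IsUnramifiedAt u) →
    ∀ (ΩK' : ℂ) (Ωp' : (unrIntegers p)ˣ) (Lφ : UnrSeries p), ΩK' ≠ 0 →
      IsKatzLFunction ι' v vbar Cbar κ γ θK ΩK' ((Ωp' : unrIntegers p) : ℂ_[p]) Lφ →
    ∃ n nφ : ℕ, FirstUnitCoeffAt L n ∧ FirstUnitCoeffAt Lφ nφ ∧
      n + ∑ w ∈ Sf, curveLocalLambda κ (W.baseChange K) w =
        2 * nφ + ∑ w ∈ Sf, (charLocalLambda ∅ κ θsub w + charLocalLambda ∅ κ θquot w)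

/-- **THE JOIN (sorry-free logic): [AN] given the datum (§2) + Theorem T′ (§3) ⇒ [AN]-3-𝟙 (stub 3a's statement).**
Instantiate §2 at the stub's binders (`2 < 3`), feeding the datum `hT W p hp hgood hred`; the binder
`∀ σ, θquot σ = 1` of the stub is not even used (T′ covers case (b) too). No mathematics.
[cite: Kriz2016, Rem. 33 (first sentence)] [cite: CastellaGrossiLeeSkinner2022, Thm. 2.2.2 with (2.16)] -/
theorem anThreeTrivial_of_pieces (hFD : AnacongOfFullDescentDatum) (hT : FullDescentAtThreeOfRed) :
    AnacongAtThreeTrivial := by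
  intro W _ _ p _ hp hgood hred hanom hlat K _ _ hK hH hHp hodd hd3 htor ι v vbar hv hvbar hne κ hκ γ _
      N _ Dt ι' hι' ΩK Ωp L hΩ hL θsub θquot hpair _ Sf hSf θK hθK Cbar hC ΩK' Ωp' Lφ hΩ' hLφ
  exact hFD W p (by omega) hgood hred hanom (hT W p hp hgood hred) hlat K hK hH hHp hodd hd3 htor ι v vbar hv
    hvbar hne κ hκ γ N Dt ι' hι' ΩK Ωp L hΩ hL θsub θquot hpair Sf hSf θK hθK Cbar hC ΩK' Ωp' Lφ hΩ' hLφ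

/-- **The join ON THE NOSE of halves' binder**: the displayed type below is the type of the hypothesis `h3` of
halves v19.1 `thm222_OPEN_of_slices` (:266–:296) and of `stub_anThreeTrivial` (:232–:262), token for token; the
proof is `anThreeTrivial_of_pieces` (definitional unfolding of `AnacongAtThreeTrivial`). So a LEAD adopting the
split feeds `halves_h3_of_pieces stub_anacongOfFullDescentDatum stub_fullDescentAtThreeOfRed` where `h3` /
`stub_anThreeTrivial` stood. [cite: Kriz2016, Rem. 33 (first sentence)] [cite: CastellaGrossiLeeSkinner2022, Thm. 2.2.2 with (2.16)] -/
theorem halves_h3_of_pieces (hFD : AnacongOfFullDescentDatum) (hT : FullDescentAtThreeOfRed) :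
    ∀ (W : WeierstrassCurve ℚ) [W.IsElliptic] [W.IsGloballyMinimal] (p : ℕ) [Fact p.Prime],
      p = 3 → Good W p → Red W p → Anom W p →
      (∀ Φ : AddSubgroup (geomTorsion W (p : ℤ)), IsRationalLine W p Φ → ¬ LineUnramifiedAt W p Φ) →
      ∀ (K : Type) [Field K] [NumberField K], IsImaginaryQuadratic K →
        SatisfiesHeegnerHypothesis (W.conductorNorm ℤ) K → SatisfiesHeegnerHypothesis p K →
        Odd (NumberField.discr K) → NumberField.discr K ≠ -3 →
        (∀ Q : (W.baseChange K).toAffine.Point, p • Q = 0 → Q = 0) →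
      ∀ (ι : K →+* ℚ_[p]) (v vbar : HeightOneSpectrum (𝓞 K)),
        (∀ x : 𝓞 K, x ∈ v.asIdeal ↔ ‖ι (x : K)‖ < 1) →
        ((p : ℕ) : 𝓞 K) ∈ vbar.asIdeal → vbar ≠ v →
      ∀ (κ : ZpExtension K p), κ.IsAnticyclotomic →
      ∀ (γ : absoluteGaloisGroup K) [Fact (κ.IsTopGenerator γ)],
      ∀ (N : ℕ) [NeZero N] (Dt : ModularParametrizationData W N),
      ∀ (ι' : PadicAlgCl p ≃+* ℂ),
        (∀ (w : InfinitePlace K) (k : 𝓞 K), k ∈ v.asIdeal ↔ ‖ι'.symm (w.embedding (k : K))‖ < 1) →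
      ∀ (ΩK : ℂ) (Ωp : (unrIntegers p)ˣ) (L : UnrSeries p), ΩK ≠ 0 →
        IsBDPLFunction ι' v κ γ Dt.f ΩK ((Ωp : unrIntegers p) : ℂ_[p]) L →
      ∀ (θsub θquot : FramedGaloisRep K (padicCoeffIntegers (∅ : Set (PadicAlgCl p))) 1),
        IsResidualPairOver (W.baseChange K) p θsub θquot → (∀ σ : absoluteGaloisGroup K, θquot σ = 1) →
      ∀ (Sf : Finset (HeightOneSpectrum (𝓞 K))),
        (∀ w : HeightOneSpectrum (𝓞 K), w ∈ Sf ↔ ((W.conductorNorm ℤ : ℤ) : 𝓞 K) ∈ w.asIdeal) →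
      ∀ (θK : HeckeCharacter K), IsHeckeCharOf ι' θquot θK →
      ∀ (Cbar : Finset (HeightOneSpectrum (𝓞 K))), (∀ u ∈ Cbar, ¬ θK.IsUnramifiedAt u) →
      ∀ (ΩK' : ℂ) (Ωp' : (unrIntegers p)ˣ) (Lφ : UnrSeries p), ΩK' ≠ 0 →
        IsKatzLFunction ι' v vbar Cbar κ γ θK ΩK' ((Ωp' : unrIntegers p) : ℂ_[p]) Lφ →
      ∃ n nφ : ℕ, FirstUnitCoeffAt L n ∧ FirstUnitCoeffAt Lφ nφ ∧
        n + ∑ w ∈ Sf, curveLocalLambda κ (W.baseChange K) w =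
          2 * nφ + ∑ w ∈ Sf, (charLocalLambda ∅ κ θsub w + charLocalLambda ∅ κ θquot w) :=
  anThreeTrivial_of_pieces hFD hT

/-- **Coverage bookkeeping (PROVED)**: at `p = 3` the datum-conditioned statement and T′ give the WHOLE
`p = 3` slice of the preprint claim's body — WITHOUT the binder `∀ σ, θquot σ = 1` — i.e. the split also covers
case (b) at `p = 3` (which is the PUBLISHED `_of_ne_one` anyway): nothing of `_OPEN` at `p = 3` is lost.
Pure logic. [cite: Kriz2016, Rem. 33 (first sentence)] [cite: CastellaGrossiLeeSkinner2022, Thm. 2.2.2 with (2.16)] -/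
theorem anThree_of_pieces (hFD : AnacongOfFullDescentDatum) (hT : FullDescentAtThreeOfRed) :
    ∀ (W : WeierstrassCurve ℚ) [W.IsElliptic] [W.IsGloballyMinimal] (p : ℕ) [Fact p.Prime],
      p = 3 → Good W p → Red W p → Anom W p →
      (∀ Φ : AddSubgroup (geomTorsion W (p : ℤ)), IsRationalLine W p Φ → ¬ LineUnramifiedAt W p Φ) →
      ∀ (K : Type) [Field K] [NumberField K], IsImaginaryQuadratic K →
        SatisfiesHeegnerHypothesis (W.conductorNorm ℤ) K → SatisfiesHeegnerHypothesis p K →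
        Odd (NumberField.discr K) → NumberField.discr K ≠ -3 →
        (∀ Q : (W.baseChange K).toAffine.Point, p • Q = 0 → Q = 0) →
      ∀ (ι : K →+* ℚ_[p]) (v vbar : HeightOneSpectrum (𝓞 K)),
        (∀ x : 𝓞 K, x ∈ v.asIdeal ↔ ‖ι (x : K)‖ < 1) →
        ((p : ℕ) : 𝓞 K) ∈ vbar.asIdeal → vbar ≠ v →
      ∀ (κ : ZpExtension K p), κ.IsAnticyclotomic →
      ∀ (γ : absoluteGaloisGroup K) [Fact (κ.IsTopGenerator γ)],
      ∀ (N : ℕ) [NeZero N] (Dt : ModularParametrizationData W N),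
      ∀ (ι' : PadicAlgCl p ≃+* ℂ),
        (∀ (w : InfinitePlace K) (k : 𝓞 K), k ∈ v.asIdeal ↔ ‖ι'.symm (w.embedding (k : K))‖ < 1) →
      ∀ (ΩK : ℂ) (Ωp : (unrIntegers p)ˣ) (L : UnrSeries p), ΩK ≠ 0 →
        IsBDPLFunction ι' v κ γ Dt.f ΩK ((Ωp : unrIntegers p) : ℂ_[p]) L →
      ∀ (θsub θquot : FramedGaloisRep K (padicCoeffIntegers (∅ : Set (PadicAlgCl p))) 1),
        IsResidualPairOver (W.baseChange K) p θsub θquot →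
      ∀ (Sf : Finset (HeightOneSpectrum (𝓞 K))),
        (∀ w : HeightOneSpectrum (𝓞 K), w ∈ Sf ↔ ((W.conductorNorm ℤ : ℤ) : 𝓞 K) ∈ w.asIdeal) →
      ∀ (θK : HeckeCharacter K), IsHeckeCharOf ι' θquot θK →
      ∀ (Cbar : Finset (HeightOneSpectrum (𝓞 K))), (∀ u ∈ Cbar, ¬ θK.IsUnramifiedAt u) →
      ∀ (ΩK' : ℂ) (Ωp' : (unrIntegers p)ˣ) (Lφ : UnrSeries p), ΩK' ≠ 0 →
        IsKatzLFunction ι' v vbar Cbar κ γ θK ΩK' ((Ωp' : unrIntegers p) : ℂ_[p]) Lφ →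
      ∃ n nφ : ℕ, FirstUnitCoeffAt L n ∧ FirstUnitCoeffAt Lφ nφ ∧
        n + ∑ w ∈ Sf, curveLocalLambda κ (W.baseChange K) w =
          2 * nφ + ∑ w ∈ Sf, (charLocalLambda ∅ κ θsub w + charLocalLambda ∅ κ θquot w) :=
  fun W _ _ p _ hp hgood hred hanom hlat K _ _ hK hH hHp hodd hd3 htor ι v vbar hv hvbar hne κ hκ γ _
      N _ Dt ι' hι' ΩK Ωp L hΩ hL θsub θquot hpair Sf hSf θK hθK Cbar hC ΩK' Ωp' Lφ hΩ' hLφ ↦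
    hFD W p (by omega) hgood hred hanom (hT W p hp hgood hred) hlat K hK hH hHp hodd hd3 htor ι v vbar hv
      hvbar hne κ hκ γ N Dt ι' hι' ΩK Ωp L hΩ hL θsub θquot hpair Sf hSf θK hθK Cbar hC ΩK' Ωp' Lφ hΩ' hLφ


/-- **Stub 3a from the Ohta-form pair** (sorry-free): `AnacongOfFullDescentDatum` and Theorem T in Ohta's
semistable generality already give halves v19.1 `stub_anThreeTrivial`'s statement — the form in which a by-name
vehicle pair (V2′ of the card: `…_of_fullDescentDatum` + the semistable p = 3 fact) would close stub 3a. -/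
theorem anThreeTrivial_of_ohtaForm (hFD : AnacongOfFullDescentDatum) (hO : FullDescentAtThreeOfSemistableRed) :
    AnacongAtThreeTrivial :=
  anThreeTrivial_of_pieces hFD (fullDescentAtThreeOfRed_of_semistable hO)

/-! ## §5 The two stubs (the ONLY `sorry`s of this file) and stub 3a recomposed -/

/-- **Stub A — [AN] given the datum, every odd `p`** (CANDIDATE composed-PUB; by-name input once a vehicle
exists: then `:= <vehicle>`). Size: bookkeeping if granted as a named fact; otherwise the CGLS §2.2 argument.
[cite: CastellaGrossiLeeSkinner2022, Thm. 2.2.1/2.2.2 with (2.16)] [cite: Kriz2016, Thm. 35, Thm. 34 (3), Rem. 33 (first sentence), Thm. 27]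
[cite: Hida2010MuInvariant, Thm. I] -/
theorem stub_anacongOfFullDescentDatum : AnacongOfFullDescentDatum := by
  sorry

/-- **Stub B — Theorem T′** (candidate PUB-composed via Ohta 2014 Prop. (3.3.3) + dictionary D1–D4, else PRE cell
theorem of the AN-3 memo §3 — referee C3 to rule; the HARDEST stub to put in the kernel: needs `a_ℓ ≡ 1 + ℓ` from
`Red`, the Hecke algebra `𝕋(N; ℤ₍₃₎)` with its Atkin–Lehner sign decomposition and Eisenstein ideal, and Ohta's
index theorem (or q-expansions of `E₂(z) − tE₂(tz)` and the Serre–Katz / CKR weight congruence mod 9) — none of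
which is in the tree; as a by-name input it is ONE fact `(h : FullDescentAtThreeOfRed)` whose instances are
decidable). [cite: Ohta2014, Prop. (3.3.3), Thm. (3.1.3)] [cite: Yoo2015, Thm. 1.1]
[cite: ChenKimingRasmussen2010, Thm. 1 (i)] [cite: Kriz2016, Thm. 34 (1)–(3), Thm. 35] [cite: AtkinLehnerMathAnn1970, Thm. 3] -/
theorem stub_fullDescentAtThreeOfRed : FullDescentAtThreeOfRed := by
  sorry

/-- **Stub 3a recomposed**: halves' `stub_anThreeTrivial` statement from Stubs A and B through the join —
what the LEAD would write in place of stub 3a's `sorry` after adopting the split. Sorry-free GIVEN the stubs.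
[cite: Kriz2016, Rem. 33 (first sentence)] [cite: CastellaGrossiLeeSkinner2022, Thm. 2.2.2 with (2.16)] -/
theorem stub3a_recomposed : AnacongAtThreeTrivial :=
  anThreeTrivial_of_pieces stub_anacongOfFullDescentDatum stub_fullDescentAtThreeOfRed

end Summit.BirchSwinnertonDyer.BirchSwinnertonDyer.Cruxes.GoodLatticeBDPValue.HalvesAnThreeSplit

end
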